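import Mathlib
import Summits.NavierStokesRegularity.NavierStokesRegularity.Theorems.EulerZoomLiouvillePowerGaugeEulerLiouvilleKelvinPhysical
import Summits.NavierStokesRegularity.NavierStokesRegularity.Theorems.EulerZoomLiouvillePowerGaugeEulerLiouvilleSwirlfreeLedgerFlow
import Literature.Analysis.FluidPDE.ParticleTrajectoryFlow
import Literature.Analysis.FluidPDE.ClassicalSolutionGlue
import Literature.Analysis.FluidPDE.VorticityCalculus
import Literature.Analysis.FluidPDE.VectorCalculusProofs
import Literature.Analysis.FluidPDE.WholeSpaceIBP
import Literature.Analysis.ODE.EvolutionMapAutonomous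
import HarnessLib

/-!
# Crux `EulerZoomLiouville.PowerGaugeEulerLiouville` (stmt-NavierStokesRegularity-19832), line `helicity-tube`, stub T1:
# MOFFATT'S PARTIAL-HELICITY INVARIANCE — coherent vortex-tube data persist backward along a drifting classical far past,
# with the same weighted helicity

Route №10 `EulerZoomLiouville` (NavierStokesRegularity), crux E.  Line `helicity-tube` (ideator ns-idea-11 g4;
`Cruxes/PowerGaugeEulerLiouville/Lines/helicity_tube.lean`, card `Lines/helicity-tube.md`), registered stub `stub_tubeTransport` (T1), proved here
with its signature `δ`-UNFOLDED in the tree's vocabulary (the line's `IsDriftingPastWith`, `TubesPersist`, `IsTubeWeight`, `weightedHelicity`,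
`driftRadius` are `def`s of the Cruxes file, which a Theorems file cannot import; the statement below is their unfolding, binder for binder, so the
skeleton fills the stub by `theorem stub_tubeTransport : Sig.stub_tubeTransport := HelicityTube.tubesPersist_of_driftingPastWith`).

THE ARGUMENT (card T1).  Let `(u,p)` be classical Euler on `(−∞,0) × ℝ³` with a drifting far past `(T₁, M, κ)` (`‖u(r,·)‖_∞ ≤ M(−r)^{−κ}`
for `r < T₁ ≤ 0`, `κ < 1`; velocity gradient bounded on compact time sets), `s < τ < T₁`, and `(χ, R)` a tube datum for `u(τ)` (`χ ∈ C^∞`,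
`|χ| ≤ 1`, `χ = 0` off `B(0,R)`, `Dχ[curl u(τ)] ≡ 0`).  On the open convex time window `S = (s−1, τ/2) ⊂ (−∞,0)` one gradient bound holds, so
the particle-trajectory maps of `u` are global smooth volume-preserving diffeomorphisms (`ODE.evolutionMap`); let `X = φ(τ, s, ·)` (time `s` to
time `τ`) and `Y = φ(s, τ, ·)` its inverse.  The avatar is `χ' := χ ∘ X`.  (i) `χ' ∈ C^∞`, `|χ'| ≤ 1`.  (ii) CONFINEMENT: `‖Y x − x‖ ≤ D`,
`D = M((−s)^{1−κ} − (−τ)^{1−κ})/(1−κ)` (`SwirlfreeLedger.norm_evolutionMap_sub_le`, sibling line `swirlfree-ledger`), hence `‖X a‖ ≥ ‖a‖ − D`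
and `χ' = 0` off `B(0, R + D)`.  (iii) FIRST INTEGRAL: by the two-time Cauchy formula `curl u(τ, X a) = DX(a) curl u(s, a)`
(`curl_evolutionMap_of_mem_Ioo`, time translation of the tree's `IsClassicalNSSolutionOn.curl_evolutionMap`) and the chain rule,
`Dχ'(a)[curl u(s,a)] = Dχ(X a)[curl u(τ, X a)] = 0`.  (iv) SAME HELICITY: `B := χ' · curl u(s)` is `C^∞`, compactly supported and divergence-free
(`div (χ' ω) = χ' div ω + Dχ'[ω] = 0`, `divergence_curl_eq_zero_holds`, `divergence_smul_apply`), so the torus-averaged KELVIN identity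
`KelvinPhysical.integral_inner_evolutionMap_eq` gives `∫ ⟪u(τ, X a), DX(a) B(a)⟫ da = ∫ ⟪u(s,a), B(a)⟫ da = ∫ χ' ⟪u(s), curl u(s)⟫`; on the left
`DX(a) B(a) = χ(X a) curl u(τ, X a)` by (iii), and the volume-preserving change of variables `x = X a`
(`KelvinPhysical.setIntegral_image_evolutionMap`, `det DX = 1`, `X` onto) turns it into `∫ χ ⟪u(τ), curl u(τ)⟫`.

* `curl_evolutionMap_of_mem_Ioo` — two-time Lagrangian Cauchy formula on an open time interval under one gradient bound;
* **`tubesPersist_of_driftingPastWith`** — the stub signature, unfolded.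

WHAT THIS IS NOT: not NS, not the crux — a helper `--supports` stmt-19832 on the line `helicity-tube` (pure kinematics of classical flows:
transport of tube data; with T2 `HelicityTube.weightedHelicity_eq_zero_of_tubesPersist` it empties the stratum `IsHelicalTubePast`); the residue
T3 (`stub_helicityRest`) stays OPEN; 19832 is a crux CLASS on the model lattice (E/NS strata); no summit statement is proved here and nothing
here bears on NS regularity itself.  [folklore; cite: MajdaBertozziCUP2002 §1.6 Props. 1.8, 1.10–1.12, §2.5 (2.115)–(2.117); Moffatt 1969]
-/

noncomputable section

-- flat `Theorems/<Route><Decl>…` files of one crux share the namespace of the crux (tree convention)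
set_option linter.dupNamespace false

open MeasureTheory Set Filter Topology Metric Function Real InnerProductSpace
open scoped NNReal ENNReal RealInnerProductSpace ContDiff

namespace Summit.NavierStokesRegularity.NavierStokesRegularity.Theorems.PowerGaugeEulerLiouville.HelicityTube

open Literature.Analysis Literature.Analysis.FluidPDE
open Summit.NavierStokesRegularity.NavierStokesRegularity.Theorems.PowerGaugeEulerLiouville.KelvinPhysical
open Summit.NavierStokesRegularity.NavierStokesRegularity.Theorems.PowerGaugeEulerLiouville.SwirlfreeLedger

variable {u : ℝ → EuclideanSpace ℝ (Fin 3) → EuclideanSpace ℝ (Fin 3)} {p : ℝ → EuclideanSpace ℝ (Fin 3) → ℝ}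

/-! ### The two-time Cauchy formula on an open time interval -/

/-- **Two-time Cauchy formula, Lagrangian form, on an open time interval.**  For a classical Euler flow on `(a, b)` whose velocity gradient
is bounded there (`‖∇u(r,·)‖ ≤ L`), and `t₀, t ∈ (a, b)`: `curl u(t, φ(t,t₀,α)) = ∇φ(t,t₀,·)(α) · curl u(t₀, α)` (time translation by `t₀` of the
tree's base-time-`0` formula `IsClassicalNSSolutionOn.curl_evolutionMap`; the translated flow is identified by `ODE.evolutionMap_comp_add_right`).
[cite: MajdaBertozziCUP2002, §1.6 Prop. 1.8 (1.51); §2.5 (2.115)–(2.117)] -/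
theorem curl_evolutionMap_of_mem_Ioo {a b : ℝ} (hcl : IsClassicalEulerSolutionOn (Ioo a b) 0 u p)
    {L : ℝ} (hL : ∀ r ∈ Ioo a b, ∀ x : EuclideanSpace ℝ (Fin 3), ‖fderiv ℝ (u r) x‖ ≤ L)
    {t₀ t : ℝ} (ht₀ : t₀ ∈ Ioo a b) (ht : t ∈ Ioo a b) (α : EuclideanSpace ℝ (Fin 3)) :
    curl (u t) (ODE.evolutionMap u t₀ t α) = fderiv ℝ (ODE.evolutionMap u t₀ t) α (curl (u t₀) α) := by
  -- adapted from …FadingTamePastTools (`FadingPast.curl_eq_fderiv_evolutionMap_apply_two_time`)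
  have hS : Convex ℝ (Ioo a b) := convex_Ioo a b
  have hLip : ODE.IsUniformlyLipschitzOn u (Ioo a b) :=
    hcl.smooth_velocity.isUniformlyLipschitzOn_of_norm_fderiv_le' hL
  -- the translated flow `v r = u (r + t₀)` on `(a − t₀, b − t₀) ∋ 0`
  set v : ℝ → EuclideanSpace ℝ (Fin 3) → EuclideanSpace ℝ (Fin 3) := fun r => u (r + t₀) with hv
  set q : ℝ → EuclideanSpace ℝ (Fin 3) → ℝ := fun r => p (r + t₀) with hq
  set S' : Set ℝ := Ioo (a - t₀) (b - t₀) with hS'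
  have hpre : (fun r : ℝ => r + t₀) ⁻¹' Ioo a b = S' := by rw [hS', preimage_add_const_Ioo]
  have hclv : IsClassicalEulerSolutionOn S' 0 v q := by
    have h1 := hcl.comp_add_right t₀
    rw [hpre] at h1
    exact h1
  have hS'c : Convex ℝ S' := convex_Ioo _ _
  have hU' : UniqueDiffOn ℝ S' := isOpen_Ioo.uniqueDiffOn
  have h0 : (0 : ℝ) ∈ S' := by rw [hS', mem_Ioo]; constructor <;> linarith [ht₀.1, ht₀.2]
  have htS' : t - t₀ ∈ S' := by rw [hS', mem_Ioo]; constructor <;> linarith [ht.1, ht.2]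
  have hLv : ODE.IsUniformlyLipschitzOn v S' := by
    refine hclv.smooth_velocity.isUniformlyLipschitzOn_of_norm_fderiv_le' (M := L) fun r hr y => ?_
    have hr' : r + t₀ ∈ Ioo a b := by rw [← hpre] at hr; exact hr
    exact hL _ hr' y
  -- the base-`0` Lagrangian Cauchy formula for `v` at time `t - t₀`
  have hcauchy := hclv.curl_evolutionMap hS'c h0 hU' hLv htS' α
  -- the flows of `v` and `u` agree up to the time shift
  obtain ⟨K, hK⟩ := hLip.exists_lipschitzWith_uIcc hS ht₀ ht
  have hfw : ODE.evolutionMap v 0 (t - t₀) = ODE.evolutionMap u t₀ t := by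
    funext y
    have h := ODE.evolutionMap_comp_add_right (v := u) (t₀ := (0 : ℝ)) (t := t - t₀) t₀ (K := K)
      (fun r hr => hK r (by simpa only [zero_add, sub_add_cancel] using hr)) y
    simpa only [zero_add, sub_add_cancel] using h
  have hvt : v (t - t₀) = u t := by simp only [hv, sub_add_cancel]
  have hv0 : v 0 = u t₀ := by simp only [hv, zero_add]
  rw [hfw, hvt, hv0] at hcauchy
  exact hcauchy

/-! ### The stub, unfolded -/

/-- **T1 `stub_tubeTransport` of the line `helicity-tube`, signature unfolded — TUBE DATA PERSIST BACKWARD WITH THEIR HELICITY.**  For a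
classical Euler solution on `(−∞,0) × ℝ³` with a drifting far past `(T₁, M, κ)` (`T₁ ≤ 0`, `0 ≤ M`, `κ < 1`, `‖u(r,x)‖ ≤ M(−r)^{−κ}` for
`r < T₁`, velocity gradient bounded on compact time sets), every tube datum `(χ, R)` of `u(τ)`, `τ < T₁` (`χ ∈ C^∞`, `|χ| ≤ 1`, `χ = 0` off
`B(0,R)`, `Dχ[curl u(τ)] ≡ 0`) has at every earlier time `s < τ` an avatar `χ'` — a tube datum of `u(s)` inside
`B(0, R + M((−s)^{1−κ} − (−τ)^{1−κ})/(1−κ))` — with the SAME weighted helicity `∫ χ' ⟪u(s), curl u(s)⟫ = ∫ χ ⟪u(τ), curl u(τ)⟫`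
(`χ' = χ ∘ φ(τ, s, ·)`; proof in the module docstring). [cite: MajdaBertozziCUP2002, §1.6 Props. 1.8, 1.10–1.11; §2.5 (2.115)–(2.117)] -/
theorem tubesPersist_of_driftingPastWith :
    ∀ (u : ℝ → EuclideanSpace ℝ (Fin 3) → EuclideanSpace ℝ (Fin 3)) (p : ℝ → EuclideanSpace ℝ (Fin 3) → ℝ) (T₁ M κ : ℝ),
      (IsClassicalEulerSolutionOn (Set.Iio 0) 0 u p ∧ T₁ ≤ 0 ∧ 0 ≤ M ∧ κ < 1 ∧
          (∀ τ : ℝ, τ < T₁ → ∀ x : EuclideanSpace ℝ (Fin 3), ‖u τ x‖ ≤ M * (-τ) ^ (-κ)) ∧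
          (∀ t₁ t₂ : ℝ, t₁ < t₂ → t₂ < 0 →
            ∃ L : ℝ, ∀ τ ∈ Set.Icc t₁ t₂, ∀ x : EuclideanSpace ℝ (Fin 3), ‖fderiv ℝ (u τ) x‖ ≤ L)) →
        ∀ τ : ℝ, τ < T₁ → ∀ (χ : EuclideanSpace ℝ (Fin 3) → ℝ) (R : ℝ), 0 < R →
          (ContDiff ℝ ∞ χ ∧ (∀ x : EuclideanSpace ℝ (Fin 3), |χ x| ≤ 1) ∧
              (∀ x : EuclideanSpace ℝ (Fin 3), R ≤ ‖x‖ → χ x = 0) ∧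
              ∀ x : EuclideanSpace ℝ (Fin 3), fderiv ℝ χ x (curl (u τ) x) = 0) →
            ∀ s : ℝ, s < τ →
              ∃ χ' : EuclideanSpace ℝ (Fin 3) → ℝ,
                (ContDiff ℝ ∞ χ' ∧ (∀ x : EuclideanSpace ℝ (Fin 3), |χ' x| ≤ 1) ∧
                    (∀ x : EuclideanSpace ℝ (Fin 3),
                      R + M / (1 - κ) * ((-s) ^ (1 - κ) - (-τ) ^ (1 - κ)) ≤ ‖x‖ → χ' x = 0) ∧
                    ∀ x : EuclideanSpace ℝ (Fin 3), fderiv ℝ χ' x (curl (u s) x) = 0) ∧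
                  ∫ x, χ' x * ⟪u s x, curl (u s) x⟫ = ∫ x, χ x * ⟪u τ x, curl (u τ) x⟫ := by
  intro u p T₁ M κ hdrift τ hτ χ R _hR hχ s hs
  obtain ⟨hcl, hT₁, _hM0, hκ1, henv, hgrad⟩ := hdrift
  obtain ⟨hχs, hχ1, hχ0, hχi⟩ := hχ
  have hτ0 : τ < 0 := lt_of_lt_of_le hτ hT₁
  -- the time window `S = (s - 1, τ/2)` and its one gradient bound
  set S : Set ℝ := Ioo (s - 1) (τ / 2) with hSdef
  have hsS : s ∈ S := by rw [hSdef, mem_Ioo]; constructor <;> linarith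
  have hτS : τ ∈ S := by rw [hSdef, mem_Ioo]; constructor <;> linarith
  have hS0 : S ⊆ Iio 0 := fun r hr => by rw [mem_Iio]; rw [hSdef, mem_Ioo] at hr; linarith [hr.2]
  have hclS : IsClassicalEulerSolutionOn S 0 u p := hcl.mono hS0 isOpen_Ioo.uniqueDiffOn
  obtain ⟨L, hL⟩ := hgrad (s - 1) (τ / 2) (by linarith) (by linarith)
  have hLS : ∀ r ∈ S, ∀ x : EuclideanSpace ℝ (Fin 3), ‖fderiv ℝ (u r) x‖ ≤ L :=
    fun r hr x => hL r (Ioo_subset_Icc_self hr) x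
  have hSc : Convex ℝ S := convex_Ioo _ _
  have hSo : IsOpen S := isOpen_Ioo
  have hSU : UniqueDiffOn ℝ S := hSo.uniqueDiffOn
  have hLip : ODE.IsUniformlyLipschitzOn u S := hclS.smooth_velocity.isUniformlyLipschitzOn_of_norm_fderiv_le' hLS
  -- the forward map `X` (time `s` to time `τ`) and its inverse `Y`
  set X : EuclideanSpace ℝ (Fin 3) → EuclideanSpace ℝ (Fin 3) := ODE.evolutionMap u s τ with hXdef
  set Y : EuclideanSpace ℝ (Fin 3) → EuclideanSpace ℝ (Fin 3) := ODE.evolutionMap u τ s with hYdef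
  have hXs : ContDiff ℝ ∞ X := contDiff_evolutionMap_slice hLip hclS.smooth_velocity hSc hSU hsS hτS
  have hYX : ∀ a, Y (X a) = a := fun a => hLip.evolutionMap_symm hSc hsS hτS a
  have hXsurj : Surjective X := (hLip.bijective_evolutionMap hSc hsS hτS).surjective
  have hcauchy : ∀ a, curl (u τ) (X a) = fderiv ℝ X a (curl (u s) a) :=
    fun a => curl_evolutionMap_of_mem_Ioo hclS hLS hsS hτS a
  -- smoothness of the slices
  have hus : ContDiff ℝ ∞ (u s) := hcl.contDiff_velocity (hs.trans hτ0)
  have hcurls : ContDiff ℝ ∞ (curl (u s)) := contDiff_curl (n := ⊤) (hus.of_le (by exact_mod_cast le_top))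
  -- confinement: `‖Y x − x‖ ≤ D`
  set D : ℝ := M / (1 - κ) * ((-s) ^ (1 - κ) - (-τ) ^ (1 - κ)) with hDdef
  have hspeed : ∀ r ∈ Icc s τ, ∀ y : EuclideanSpace ℝ (Fin 3), ‖u r y‖ ≤ M * (-r) ^ (-κ) :=
    fun r hr y => henv r (lt_of_le_of_lt hr.2 hτ) y
  have hconf : ∀ x, ‖Y x - x‖ ≤ D := fun x =>
    norm_evolutionMap_sub_le hLip hSc hSo hsS hτS hτ0 hκ1 hspeed x ⟨le_rfl, hs.le⟩
  have hXfar : ∀ a : EuclideanSpace ℝ (Fin 3), R + D ≤ ‖a‖ → R ≤ ‖X a‖ := by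
    intro a ha
    have h1 : ‖a - X a‖ ≤ D := by have h := hconf (X a); rwa [hYX] at h
    have h2 : ‖a‖ - ‖X a‖ ≤ ‖a - X a‖ := norm_sub_norm_le a (X a)
    linarith
  -- the avatar
  set χ' : EuclideanSpace ℝ (Fin 3) → ℝ := χ ∘ X with hχ'def
  have hχ's : ContDiff ℝ ∞ χ' := hχs.comp hXs
  have hχ'0 : ∀ a : EuclideanSpace ℝ (Fin 3), R + D ≤ ‖a‖ → χ' a = 0 := fun a ha => by
    rw [hχ'def, Function.comp_apply]
    exact hχ0 (X a) (hXfar a ha)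
  have hχ'i : ∀ a : EuclideanSpace ℝ (Fin 3), fderiv ℝ χ' a (curl (u s) a) = 0 := by
    intro a
    have hd1 : DifferentiableAt ℝ χ (X a) := (hχs.differentiable (by simp)) (X a)
    have hd2 : DifferentiableAt ℝ X a := (hXs.differentiable (by simp)) a
    rw [hχ'def, fderiv_comp a hd1 hd2, ContinuousLinearMap.comp_apply, ← hcauchy a]
    exact hχi (X a)
  refine ⟨χ', ⟨hχ's, fun a => hχ1 (X a), hχ'0, hχ'i⟩, ?_⟩
  -- ### the same helicity
  -- the test field `B = χ' · curl u(s)`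
  set B : EuclideanSpace ℝ (Fin 3) → EuclideanSpace ℝ (Fin 3) := fun a => χ' a • curl (u s) a with hBdef
  have hB : ContDiff ℝ ∞ B := hχ's.smul hcurls
  have hBc : HasCompactSupport B := by
    refine HasCompactSupport.intro (isCompact_closedBall (0 : EuclideanSpace ℝ (Fin 3)) (R + D)) fun a ha => ?_
    rw [mem_closedBall, dist_zero_right, not_le] at ha
    simp only [hBdef, hχ'0 a ha.le, zero_smul]
  have hBdiv : VectorCalculus.IsDivFree B := by
    intro a
    have hd1 : DifferentiableAt ℝ χ' a := (hχ's.differentiable (by simp)) a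
    have hd2 : DifferentiableAt ℝ (curl (u s)) a := (hcurls.differentiable (by simp)) a
    have hdivω : VectorCalculus.divergence (curl (u s)) a = 0 :=
      divergence_curl_eq_zero_holds (u s) (hus.of_le (by norm_cast)) a
    have hgrad' : ⟪curl (u s) a, gradient χ' a⟫ = fderiv ℝ χ' a (curl (u s) a) := by
      rw [gradient, real_inner_comm, InnerProductSpace.toDual_symm_apply]
    show VectorCalculus.divergence (fun y => χ' y • curl (u s) y) a = 0
    rw [divergence_smul_apply hd1 hd2, hdivω, mul_zero, zero_add, hgrad', hχ'i a]
  -- Kelvin, torus-averaged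
  have hK := integral_inner_evolutionMap_eq hclS hLip hSc hSo hsS hτS hB hBc hBdiv
  -- the right-hand side is the helicity of the avatar
  have hrhs : ∫ a, ⟪u s a, B a⟫ = ∫ a, χ' a * ⟪u s a, curl (u s) a⟫ := by
    refine integral_congr_ae (ae_of_all _ fun a => ?_)
    simp only [hBdef, real_inner_smul_right]
  -- the left-hand side is `∫ G ∘ X`, `G = χ ⟪u(τ), curl u(τ)⟫`
  set G : EuclideanSpace ℝ (Fin 3) → ℝ := fun x => χ x * ⟪u τ x, curl (u τ) x⟫ with hGdef
  have hlhs : ∫ a, ⟪u τ (ODE.evolutionMap u s τ a), fderiv ℝ (ODE.evolutionMap u s τ) a (B a)⟫ = ∫ a, G (X a) := by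
    refine integral_congr_ae (ae_of_all _ fun a => ?_)
    simp only [hBdef, hGdef, map_smul, real_inner_smul_right]
    rw [← hXdef, ← hcauchy a, hχ'def, Function.comp_apply]
  -- change of variables `x = X a` (volume preserving, `X` onto)
  have hcov : ∫ a, G (X a) = ∫ x, G x := by
    have h := setIntegral_image_evolutionMap hclS hLip hSc hSU hsS hτS MeasurableSet.univ G
    rw [← hXdef, image_univ_of_surjective hXsurj, setIntegral_univ, setIntegral_univ] at h
    exact h.symm
  rw [← hrhs, ← hK, hlhs, hcov]

end Summit.NavierStokesRegularity.NavierStokesRegularity.Theorems.PowerGaugeEulerLiouville.HelicityTube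

end
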